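import Mathlib

/-!
# Radix residue on the lattice: the Mahler coefficient identity

For a multiscale product `F * expand M C` (where `MvPolynomial.expand M` substitutes
`x ↦ x^M`, `y ↦ y^M`), the coefficients on the lattice `M • ℕ²` are those of the smaller
instance `F₀ * C`, where `F₀` is the lattice part of `F` read at scale `1/M`, characterised
abstractly by `coeff d F₀ = coeff (M • d) F`.

The proof writes `C` as a sum of monomials (`MvPolynomial.as_sum`), pushes `expand M` and the
products through the sums, and compares termwise via `MvPolynomial.coeff_mul_monomial'`, using
that for `M ≥ 1` scaling by `M` is an order embedding of `Fin 2 →₀ ℕ` compatible with truncated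
subtraction.
-/

set_option linter.dupNamespace false

namespace Summit.ValiantsHypothesis.ValiantsHypothesis.Theorems.TwoProducts.RadixResidueOn

/-- For `M ≥ 1`, scaling exponent vectors by `M` reflects and preserves the coordinatewise
order: `M • b ≤ M • q ↔ b ≤ q`. -/
theorem smul_le_smul_iff_of_one_le {M : ℕ} (hM : 1 ≤ M) (b q : Fin 2 →₀ ℕ) :
    M • b ≤ M • q ↔ b ≤ q := by
  simp only [Finsupp.le_def, Finsupp.smul_apply, smul_eq_mul]
  constructor
  · intro h i
    exact Nat.le_of_mul_le_mul_left (h i) (by omega)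
  · intro h i
    exact Nat.mul_le_mul_left M (h i)

/-- Scaling exponent vectors by `M` commutes with truncated subtraction:
`M • q - M • b = M • (q - b)`. -/
theorem smul_tsub_smul (M : ℕ) (b q : Fin 2 →₀ ℕ) :
    M • q - M • b = M • (q - b) := by
  ext i
  simp only [Finsupp.tsub_apply, Finsupp.smul_apply, smul_eq_mul]
  rw [mul_tsub]

/-- **Mahler coefficient identity** (radix residue on the lattice). If `M ≥ 1` and `F₀` is the
lattice part of `F` at scale `1/M`, i.e. `coeff d F₀ = coeff (M • d) F` for all `d`, then for
every `q`, the coefficient of `F * expand M C` at the lattice point `M • q` equals the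
coefficient of `F₀ * C` at `q`. -/
theorem stub_radixResidueOn : ∀ (M : ℕ) (F F₀ C : MvPolynomial (Fin 2) ℂ), 1 ≤ M →
    (∀ d : Fin 2 →₀ ℕ, MvPolynomial.coeff d F₀ = MvPolynomial.coeff (M • d) F) →
    ∀ q : Fin 2 →₀ ℕ, MvPolynomial.coeff (M • q) (F * MvPolynomial.expand M C) =
      MvPolynomial.coeff q (F₀ * C) := by
  intro M F F₀ C hM hF₀ q
  conv_lhs => rw [C.as_sum]
  conv_rhs => rw [C.as_sum]
  rw [map_sum, Finset.mul_sum, Finset.mul_sum, MvPolynomial.coeff_sum, MvPolynomial.coeff_sum]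
  refine Finset.sum_congr rfl fun b _ => ?_
  rw [MvPolynomial.expand_monomial, MvPolynomial.coeff_mul_monomial',
    MvPolynomial.coeff_mul_monomial']
  by_cases hb : b ≤ q
  · rw [if_pos ((smul_le_smul_iff_of_one_le hM b q).mpr hb), if_pos hb, smul_tsub_smul, hF₀]
  · rw [if_neg (fun h => hb ((smul_le_smul_iff_of_one_le hM b q).mp h)), if_neg hb]

end Summit.ValiantsHypothesis.ValiantsHypothesis.Theorems.TwoProducts.RadixResidueOn
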